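import Mathlib.Analysis.Calculus.ContDiff.Basic
import Mathlib.Analysis.Calculus.ContDiff.Operations
import Mathlib.Analysis.Calculus.IteratedDeriv.Defs
import Mathlib.Analysis.Calculus.Deriv.Comp
import Mathlib.Analysis.Calculus.Deriv.Mul
import Mathlib.Analysis.Calculus.Deriv.Add
import HarnessLib

/-!
# Iterated Fréchet derivatives as nested directional derivatives

Generic word calculus for `iteratedFDeriv ℝ n g x m` read on a word `m = (v₀, …, v_{n−1})` of constant vectors (Mathlib-only):

* (W2) **peel-left**: `Dⁿ⁺¹g(x)[v ∷ m] = ∂_v (y ↦ Dⁿg(y)[m]) (x)` — as an `fderiv`, as a `HasDerivAt` along the ray `t ↦ x + t • v`, and as `deriv … 0`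
  (`ContDiffAt ℝ N g x`, `n < N`);
* (W1) **ray**: `Dⁿg(p + t•v)[v, …, v] = (d/dt)ⁿ (t ↦ g (p + t•v))` for `g` of class `C^N`, `n ≤ N`, on an open set (local) or everywhere (global), and the
  multilinear rescaling `Dⁿg(·)[a₀v, …, a_{n−1}v] = (∏ aᵢ) • Dⁿg(·)[v,…,v]`;
* (W3) **affine pull-back** (hypothesis-free): for a continuous linear equivalence `L` and a translation `c`,
  `Dⁿ(G ∘ (L · + c))(x)[m] = DⁿG(Lx + c)[L ∘ m]`, i.e. nested directional derivatives of the pull-back along the `L`-coordinate vectors `L⁻¹wᵢ` are the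
  nested partials of `G` on the word `w`;
* (W3-loc, ED. 2) the LOCAL chain rule for a possibly non-invertible continuous linear map `A` (+ translation) when `G` is only `C^N` on an OPEN set
  (`Dⁿ(G ∘ A)(x)[m] = DⁿG(Ax)[A ∘ m]`, Mathlib `ContinuousLinearMap.iteratedFDerivWithin_comp_right` read without `Within`).

These are the chain rule and the inductive definition of the `k`-th differential `f^{(k)}` [Hörmander, ALPDO I, §1.1 (1.1.3) and pp. 10–11], packaged for
consumers that read jets on adapted words (Harish-Chandra jump relations).  THEOREMS ONLY; no definition, no instance, no notation.

NEIGHBOURS IN THE TREE (cited, not restated): ★ `Literature.Analysis.Calculus.iteratedFDeriv_succ_apply_eq_iteratedFDeriv_fderiv_apply` ∕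
`iteratedFDeriv_apply_eq_foldr_fderiv` ∕ `iteratedFDeriv_apply_const_eq_iterate_fderiv` (`IteratedFDerivNestedPartials`: peel-RIGHT, innermost = last slot, and
the pure word as the ITERATE `(D_v)^[n]`), ★ `iteratedDirDeriv_eq_iteratedDeriv_lineRestrict` (`IteratedFDerivBasisBounds` §3: `(D_v)^[a] g = (d/dt)^a` of the
line restriction, `C^∞` on an open set), ★ `iteratedFDeriv_comp_clm_apply` (`NestedFDerivCompContinuousLinear`: a continuous linear map under GLOBAL `ContDiff`),
Mathlib `iteratedFDeriv_succ_apply_left` ∕ `ContinuousLinearEquiv.iteratedFDerivWithin_comp_right` ∕ `iteratedFDeriv_comp_add_right`.  What is added here: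
peel-LEFT with the evaluation moved inside the `fderiv` (first slot = outermost directional derivative of the scalar-valued jet `y ↦ Dⁿg(y)[m]`), the DIRECT
finite-order identity `Dⁿg(p + t•v)[v,…,v] = (d/dt)ⁿ g(p + t•v)` for `C^N`, `n ≤ N` (no iterate idiom, no auxiliary interval), and the HYPOTHESIS-FREE affine
pull-back along a continuous linear EQUIVALENCE with translation.

## References
* [HormanderALPDO1] L. Hörmander, *The Analysis of Linear Partial Differential Operators I*, 2nd ed., Springer (1990∕2003), §1.1: (1.1.3) (chain rule) p. 8,
  the `k`-th differential `f^{(k)} ∈ L^k(U, V)` and Thm. 1.1.8 pp. 10–11, Taylor's formula (1.1.7) along `t ↦ x + ty` p. 11.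
-/

set_option autoImplicit false

noncomputable section

open Set Filter Topology

namespace Literature.Analysis.Calculus.NestedDirectional

variable {E F : Type*} [NormedAddCommGroup E] [NormedSpace ℝ E] [NormedAddCommGroup F] [NormedSpace ℝ F]

/-! ## (W2) Peel-left: the first letter of the word is a directional derivative of the shorter jet -/

section PeelLeft

/-- **(W2, ray form)** `d/ds Dⁿg(x + s•v)[m] |_{s=t} = Dⁿ⁺¹g(x + t•v)[v ∷ m]` whenever `g` is `C^N` at `x + t•v` with `n < N` (chain rule along the ray, then the
inductive definition `f^{(n+1)} = (f^{(n)})'`). [cite: HormanderALPDO1, §1.1 (1.1.3) p. 8 and the definition of f^(k) p. 10] -/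
theorem hasDerivAt_iteratedFDeriv_apply_ray {g : E → F} {N : WithTop ℕ∞} {n : ℕ} (x v : E) (m : Fin n → E) (t : ℝ)
    (hg : ContDiffAt ℝ N g (x + t • v)) (hn : (n : WithTop ℕ∞) < N) :
    HasDerivAt (fun s : ℝ => iteratedFDeriv ℝ n g (x + s • v) m) (iteratedFDeriv ℝ (n + 1) g (x + t • v) (Fin.cons v m)) t := by
  have hd : DifferentiableAt ℝ (iteratedFDeriv ℝ n g) (x + t • v) := hg.differentiableAt_iteratedFDeriv hn
  have hline : HasDerivAt (fun s : ℝ => x + s • v) v t := by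
    simpa using ((hasDerivAt_id t).smul_const v).const_add x
  have hcomp : HasDerivAt (fun s : ℝ => iteratedFDeriv ℝ n g (x + s • v)) (fderiv ℝ (iteratedFDeriv ℝ n g) (x + t • v) v) t :=
    hd.hasFDerivAt.comp_hasDerivAt t hline
  have heval := ((ContinuousMultilinearMap.apply ℝ (fun _ : Fin n => E) F m).hasFDerivAt).comp_hasDerivAt t hcomp
  rw [iteratedFDeriv_succ_apply_left, Fin.cons_zero, Fin.tail_cons]
  exact heval

/-- **(W2, `fderiv` form)** `Dⁿ⁺¹g(x)[v ∷ m] = fderiv (y ↦ Dⁿg(y)[m]) x v` for `g` of class `C^N` at `x`, `n < N`.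
[cite: HormanderALPDO1, §1.1 (1.1.3) p. 8 and the definition of f^(k) p. 10] -/
theorem iteratedFDeriv_succ_apply_cons_eq_fderiv {g : E → F} {N : WithTop ℕ∞} {n : ℕ} {x : E} (hg : ContDiffAt ℝ N g x)
    (hn : (n : WithTop ℕ∞) < N) (v : E) (m : Fin n → E) :
    iteratedFDeriv ℝ (n + 1) g x (Fin.cons v m) = fderiv ℝ (fun y => iteratedFDeriv ℝ n g y m) x v := by
  have hd : DifferentiableAt ℝ (iteratedFDeriv ℝ n g) x := hg.differentiableAt_iteratedFDeriv hn
  have hcomp : HasFDerivAt (fun y => iteratedFDeriv ℝ n g y m)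
      ((ContinuousMultilinearMap.apply ℝ (fun _ : Fin n => E) F m).comp (fderiv ℝ (iteratedFDeriv ℝ n g) x)) x :=
    (ContinuousMultilinearMap.apply ℝ (fun _ : Fin n => E) F m).hasFDerivAt.comp x hd.hasFDerivAt
  rw [hcomp.fderiv, iteratedFDeriv_succ_apply_left, Fin.cons_zero, Fin.tail_cons]
  rfl

/-- **(W2, `deriv` form)** `Dⁿ⁺¹g(x)[v ∷ m] = d/dt|_{t=0} Dⁿg(x + t•v)[m]` for `g` of class `C^N` at `x`, `n < N`.
[cite: HormanderALPDO1, §1.1 (1.1.3) p. 8 and the definition of f^(k) p. 10] -/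
theorem iteratedFDeriv_succ_apply_cons_eq_deriv_ray {g : E → F} {N : WithTop ℕ∞} {n : ℕ} {x : E} (hg : ContDiffAt ℝ N g x)
    (hn : (n : WithTop ℕ∞) < N) (v : E) (m : Fin n → E) :
    iteratedFDeriv ℝ (n + 1) g x (Fin.cons v m) = deriv (fun t : ℝ => iteratedFDeriv ℝ n g (x + t • v) m) 0 := by
  have hg0 : ContDiffAt ℝ N g (x + (0 : ℝ) • v) := by simpa using hg
  have h := (hasDerivAt_iteratedFDeriv_apply_ray x v m 0 hg0 hn).deriv
  rw [h, zero_smul, add_zero]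

end PeelLeft

/-! ## (W1) Ray: a jet on the constant word `(v, …, v)` is an ordinary `n`-th derivative along the ray -/

section Ray

omit [NormedAddCommGroup E] [NormedSpace ℝ E] in
/-- The word `v ∷ (v, …, v)` is the constant word (plumbing). [folklore] -/
private theorem cons_const_eq_const (v : E) (n : ℕ) : (Fin.cons v (fun _ : Fin n => v) : Fin (n + 1) → E) = fun _ => v := by
  funext i
  refine Fin.cases ?_ (fun j => ?_) i <;> rfl

/-- **(W1, local)** On an open `U` where `g` is `C^N`, for `n ≤ N` and `p + t•v ∈ U`:
`Dⁿg(p + t•v)[v, …, v] = (d/ds)ⁿ (s ↦ g (p + s•v)) (t)` — Taylor's directional derivatives. [cite: HormanderALPDO1, §1.1 (1.1.7) p. 11 and (1.1.3) p. 8] -/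
theorem iteratedFDeriv_apply_const_eq_iteratedDeriv_ray {U : Set E} (hU : IsOpen U) {g : E → F} {N : WithTop ℕ∞}
    (hg : ContDiffOn ℝ N g U) (p v : E) {n : ℕ} (hn : (n : WithTop ℕ∞) ≤ N) {t : ℝ} (ht : p + t • v ∈ U) :
    iteratedFDeriv ℝ n g (p + t • v) (fun _ => v) = iteratedDeriv n (fun s : ℝ => g (p + s • v)) t := by
  induction n generalizing t with
  | zero => simp
  | succ n ih =>
    have hn' : (n : WithTop ℕ∞) < N := lt_of_lt_of_le (by exact_mod_cast Nat.lt_succ_self n) hn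
    have hV : ∀ᶠ s in 𝓝 t, p + s • v ∈ U :=
      (by fun_prop : Continuous fun s : ℝ => p + s • v).continuousAt.preimage_mem_nhds (hU.mem_nhds ht)
    have hEq : (fun s => iteratedDeriv n (fun s : ℝ => g (p + s • v)) s) =ᶠ[𝓝 t]
        fun s => iteratedFDeriv ℝ n g (p + s • v) (fun _ => v) :=
      hV.mono fun s hs => (ih (le_of_lt hn') hs).symm
    rw [iteratedDeriv_succ, hEq.deriv_eq,
      (hasDerivAt_iteratedFDeriv_apply_ray p v (fun _ => v) t (hg.contDiffAt (hU.mem_nhds ht)) hn').deriv, cons_const_eq_const]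

/-- **(W1, global)** For `g` of class `C^N` and `n ≤ N`: `Dⁿg(p + t•v)[v, …, v] = (d/ds)ⁿ (s ↦ g (p + s•v)) (t)`.
[cite: HormanderALPDO1, §1.1 (1.1.7) p. 11 and (1.1.3) p. 8] -/
theorem iteratedFDeriv_apply_const_eq_iteratedDeriv_ray_of_contDiff {g : E → F} {N : WithTop ℕ∞} (hg : ContDiff ℝ N g) (p v : E) {n : ℕ}
    (hn : (n : WithTop ℕ∞) ≤ N) (t : ℝ) :
    iteratedFDeriv ℝ n g (p + t • v) (fun _ => v) = iteratedDeriv n (fun s : ℝ => g (p + s • v)) t :=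
  iteratedFDeriv_apply_const_eq_iteratedDeriv_ray isOpen_univ hg.contDiffOn p v hn (mem_univ _)

/-- **(W1, at the base point)** `Dⁿg(p)[v, …, v] = (d/ds)ⁿ (s ↦ g (p + s•v)) (0)` on an open `U ∋ p` where `g` is `C^N`, `n ≤ N`.
[cite: HormanderALPDO1, §1.1 (1.1.7) p. 11 and (1.1.3) p. 8] -/
theorem iteratedFDeriv_apply_const_eq_iteratedDeriv_ray_zero {U : Set E} (hU : IsOpen U) {g : E → F} {N : WithTop ℕ∞}
    (hg : ContDiffOn ℝ N g U) {p : E} (hp : p ∈ U) (v : E) {n : ℕ} (hn : (n : WithTop ℕ∞) ≤ N) :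
    iteratedFDeriv ℝ n g p (fun _ => v) = iteratedDeriv n (fun s : ℝ => g (p + s • v)) 0 := by
  have hp0 : p + (0 : ℝ) • v ∈ U := by simpa using hp
  simpa using iteratedFDeriv_apply_const_eq_iteratedDeriv_ray hU hg p v hn hp0

/-- **(W1, rescaled word)** `Dⁿg(x)[a₀•v, …, a_{n−1}•v] = (∏ aᵢ) • Dⁿg(x)[v, …, v]` (multilinearity; no differentiability needed).
[cite: HormanderALPDO1, §1.1, f^(k) ∈ L^k(U, V) p. 10] -/
theorem iteratedFDeriv_apply_smul_const (g : E → F) (x v : E) {n : ℕ} (a : Fin n → ℝ) :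
    iteratedFDeriv ℝ n g x (fun i => a i • v) = (∏ i, a i) • iteratedFDeriv ℝ n g x (fun _ => v) := by
  rw [← ContinuousMultilinearMap.map_smul_univ]

end Ray

/-! ## (W3) Affine pull-back: jets of `G ∘ (L · + c)` on `L`-coordinate words are the partial jets of `G` (hypothesis-free) -/

section Affine

variable {E' : Type*} [NormedAddCommGroup E'] [NormedSpace ℝ E']

/-- **(W3)** For a continuous linear equivalence `L : E ≃L E'` and `c : E'`, with NO differentiability hypothesis:
`Dⁿ(y ↦ G(Ly + c))(x)[m] = DⁿG(Lx + c)[L m₀, …, L m_{n−1}]` (chain rule for an affine isomorphism). [cite: HormanderALPDO1, §1.1 (1.1.3) p. 8 and pp. 10–11] -/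
theorem iteratedFDeriv_comp_continuousLinearEquiv_add_apply (L : E ≃L[ℝ] E') (c : E') (G : E' → F) (x : E) (n : ℕ) (m : Fin n → E) :
    iteratedFDeriv ℝ n (fun y => G (L y + c)) x m = iteratedFDeriv ℝ n G (L x + c) (fun i => L (m i)) := by
  have h1 : (fun y => G (L y + c)) = (fun z => G (z + c)) ∘ L := rfl
  have h2 := L.iteratedFDerivWithin_comp_right (fun z => G (z + c)) uniqueDiffOn_univ (mem_univ (L x)) n
  simp only [preimage_univ, iteratedFDerivWithin_univ] at h2
  rw [h1, h2, ContinuousMultilinearMap.compContinuousLinearMap_apply, iteratedFDeriv_comp_add_right]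
  rfl

/-- **(W3, coordinate words)** nested directional derivatives of the pull-back `y ↦ G(Ly + c)` along the `L`-coordinate vectors `L⁻¹ wᵢ` ARE the nested partials
of `G` on the word `w`: `Dⁿ(G ∘ A)(x)[L⁻¹w₀, …] = DⁿG(Ax)[w₀, …]`. [cite: HormanderALPDO1, §1.1 (1.1.3) p. 8 and pp. 10–11] -/
theorem iteratedFDeriv_comp_continuousLinearEquiv_add_apply_symm (L : E ≃L[ℝ] E') (c : E') (G : E' → F) (x : E) (n : ℕ)
    (w : Fin n → E') :
    iteratedFDeriv ℝ n (fun y => G (L y + c)) x (fun i => L.symm (w i)) = iteratedFDeriv ℝ n G (L x + c) w := by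
  rw [iteratedFDeriv_comp_continuousLinearEquiv_add_apply]
  simp

/-- **(W3, smoothness transport)** `G` of class `C^N` on `U` pulls back to `y ↦ G(Ly + c)` of class `C^N` on the preimage of `U`. [cite: HormanderALPDO1, §1.1 p. 10 (C^k is closed under composition)] -/
theorem contDiffOn_comp_continuousLinearEquiv_add (L : E ≃L[ℝ] E') (c : E') {G : E' → F} {N : WithTop ℕ∞} {U : Set E'} (hG : ContDiffOn ℝ N G U) :
    ContDiffOn ℝ N (fun y => G (L y + c)) ((fun y => L y + c) ⁻¹' U) :=
  by
  have hA : ContDiff ℝ N (fun y : E => L y + c) := L.contDiff.add contDiff_const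
  exact hG.comp hA.contDiffOn (fun _ hy => hy)

/-- **(W3) + (W1)**: the `n`-th partial of `G` at `Lx + c` in the direction `w`, read as an ordinary derivative of the pull-back along the ray `x + t • L⁻¹w`:
`DⁿG(Lx + c)[w, …, w] = (d/dt)ⁿ (t ↦ G(L(x + t•L⁻¹w) + c)) (0)` for `G` of class `C^N` on an open `U ∋ Lx + c`, `n ≤ N`.
[cite: HormanderALPDO1, §1.1 (1.1.3) p. 8, (1.1.7) p. 11] -/
theorem iteratedFDeriv_apply_const_eq_iteratedDeriv_pullback_ray (L : E ≃L[ℝ] E') (c : E') {G : E' → F} {N : WithTop ℕ∞} {U : Set E'}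
    (hU : IsOpen U) (hG : ContDiffOn ℝ N G U) {x : E} (hx : L x + c ∈ U) (w : E') {n : ℕ} (hn : (n : WithTop ℕ∞) ≤ N) :
    iteratedFDeriv ℝ n G (L x + c) (fun _ => w) = iteratedDeriv n (fun t : ℝ => G (L (x + t • L.symm w) + c)) 0 := by
  have hU' : IsOpen ((fun y => L y + c) ⁻¹' U) := hU.preimage (by fun_prop)
  rw [← iteratedFDeriv_comp_continuousLinearEquiv_add_apply_symm L c G x n (fun _ => w),
    iteratedFDeriv_apply_const_eq_iteratedDeriv_ray_zero hU' (contDiffOn_comp_continuousLinearEquiv_add L c hG) hx (L.symm w) hn]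

end Affine


/-! ## (W3-loc) (ED. 2) Local chain rule for a possibly NON-invertible continuous linear map, `G` only `C^N` on an open set -/

section AffineLocal

variable {E' : Type*} [NormedAddCommGroup E'] [NormedSpace ℝ E']

/-- **(W3-loc)** LOCAL chain rule for a (possibly NON-invertible) continuous linear map on the right: for `G` of class `C^N` on an OPEN `V`, `A x ∈ V`, `n ≤ N`,
`Dⁿ(G ∘ A)(x)[m] = DⁿG(Ax)[A m₀, …, A m_{n−1}]` (Mathlib `ContinuousLinearMap.iteratedFDerivWithin_comp_right` on the open `A ⁻¹' V`, read without `Within`).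
[cite: HormanderALPDO1, §1.1 (1.1.3) p. 8 and pp. 10–11] -/
theorem iteratedFDeriv_comp_clm_apply_of_isOpen (A : E →L[ℝ] E') {G : E' → F} {V : Set E'} (hV : IsOpen V) {N : WithTop ℕ∞}
    (hG : ContDiffOn ℝ N G V) {x : E} (hx : A x ∈ V) {n : ℕ} (hn : (n : WithTop ℕ∞) ≤ N) (m : Fin n → E) :
    iteratedFDeriv ℝ n (G ∘ A) x m = iteratedFDeriv ℝ n G (A x) (fun i => A (m i)) := by
  have hV' : IsOpen (A ⁻¹' V) := hV.preimage A.continuous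
  have h := A.iteratedFDerivWithin_comp_right hG hV.uniqueDiffOn hV'.uniqueDiffOn hx hn
  rw [← iteratedFDerivWithin_of_isOpen n hV' (show x ∈ A ⁻¹' V from hx), h, ContinuousMultilinearMap.compContinuousLinearMap_apply,
    iteratedFDerivWithin_of_isOpen n hV hx]

/-- **(W3-loc) + translation**: `Dⁿ(y ↦ G(Ay + c))(x)[m] = DⁿG(Ax + c)[A ∘ m]` for `G` `C^N` on an open `V ∋ Ax + c`, `n ≤ N`, `A` any continuous linear map.
[cite: HormanderALPDO1, §1.1 (1.1.3) p. 8 and pp. 10–11] -/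
theorem iteratedFDeriv_comp_clm_add_apply_of_isOpen (A : E →L[ℝ] E') (c : E') {G : E' → F} {V : Set E'} (hV : IsOpen V) {N : WithTop ℕ∞}
    (hG : ContDiffOn ℝ N G V) {x : E} (hx : A x + c ∈ V) {n : ℕ} (hn : (n : WithTop ℕ∞) ≤ N) (m : Fin n → E) :
    iteratedFDeriv ℝ n (fun y => G (A y + c)) x m = iteratedFDeriv ℝ n G (A x + c) (fun i => A (m i)) := by
  have hVc : IsOpen ((fun z => z + c) ⁻¹' V) := hV.preimage (continuous_id.add continuous_const)
  have hGc : ContDiffOn ℝ N (fun z => G (z + c)) ((fun z => z + c) ⁻¹' V) :=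
    hG.comp (contDiff_id.add contDiff_const).contDiffOn (fun _ hz => hz)
  have h1 : (fun y => G (A y + c)) = (fun z => G (z + c)) ∘ A := rfl
  rw [h1, iteratedFDeriv_comp_clm_apply_of_isOpen A hVc hGc (show A x ∈ (fun z => z + c) ⁻¹' V from hx) hn m, iteratedFDeriv_comp_add_right]

end AffineLocal

end Literature.Analysis.Calculus.NestedDirectional

end
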